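import Summits.MatrixMultiplication.MatrixMultiplication.Theorems.SoloInformedCwTwoOnePairDesign
import Summits.MatrixMultiplication.MatrixMultiplication.Theorems.SoloInformedCwTwoOrientHall

/-!
# Oriented Theorem A: the T-orientation works for every one-pair mixed design (solo-informed, gen 13)

`SoloInformedCwTwoOnePairClosure` / `SoloInformedCwTwoOnePairDesign` prove MIXED CLOSURE for `p = 1` through the
injectivity of the map `Ψ` whose only trade is `s + d ↦ 2s`.  Here the same argument is repackaged as a statement
about ORIENTATIONS: for every one-pair mixed design the orientation `T` (trade towards `2s`, Boolean `false`)
WORKS, `onePair_orientedHallSix_T`.  This is the base case needed by inductions on the number of pairs through the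
demotion lemma (`SoloInformedCwTwoDemotion`, `SoloInformedCwTwoHalfInduction`), e.g. for CONJECTURE L.

Standard axioms only.
-/

namespace Summit.MatrixMultiplication.MatrixMultiplication.Theorems

open Finset

/-- Injectivity of `Ψ` under the hypotheses of Theorem A (the combinatorial core of `onePair_mixed_closure`). -/
theorem psi_injective {q : ℕ} (t : Fin q → ℕ) (s d : ℕ)
    (hdiss : ∀ A B : Finset (Fin q), subsetSum t A = subsetSum t B → A = B)
    (hs : ∀ A B : Finset (Fin q), subsetSum t B ≠ s + subsetSum t A)
    (hd : ∀ A B : Finset (Fin q), subsetSum t B ≠ d + subsetSum t A)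
    (hds : ∀ A B : Finset (Fin q), s + subsetSum t B ≠ d + subsetSum t A)
    (hconst : ∀ A₁ A₂ B : Finset (Fin q),
      subsetSum t B = s + d + subsetSum t A₁ → 2 * s + subsetSum t A₁ ≠ d + subsetSum t A₂) :
    Function.Injective (psi t s d) := by
  classical
  have key : ∀ (A B : Finset (Fin q)), pairValue t s d A = pairValue t s d B → A = B := by
    intro A B h
    unfold pairValue at h
    split_ifs at h with h1 h2 h2
    · exact hdiss A B (by omega)
    · exact absurd (by omega : s + subsetSum t A = d + subsetSum t B) (hds B A)
    · exact absurd (by omega : s + subsetSum t B = d + subsetSum t A) (hds A B)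
    · exact hdiss A B (by omega)
  have k0 : ∀ (A B : Finset (Fin q)), subsetSum t A = pairValue t s d B → False := by
    intro A B h
    unfold pairValue at h
    split_ifs at h with h1
    · obtain ⟨B₀, hB₀⟩ := h1
      exact hds A B₀ (by omega)
    · exact h1 ⟨A, h⟩
  have k1 : ∀ (A B : Finset (Fin q)), s + subsetSum t A = pairValue t s d B → False := by
    intro A B h
    unfold pairValue at h
    split_ifs at h with h1
    · exact hs B A (by omega)
    · exact hd B A (by omega)
  have k2 : ∀ (A B : Finset (Fin q)), d + subsetSum t A = pairValue t s d B → False := by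
    intro A B h
    unfold pairValue at h
    split_ifs at h with h1
    · obtain ⟨B₀, hB₀⟩ := h1
      exact hconst B A B₀ hB₀ (by omega)
    · exact hs B A (by omega)
  rintro ⟨i, A⟩ ⟨j, B⟩ h
  unfold psi at h
  fin_cases i <;> fin_cases j <;> simp at h
  all_goals first
    | exact (hs A B (by omega)).elim
    | exact (hs B A (by omega)).elim
    | exact (hd A B (by omega)).elim
    | exact (hd B A (by omega)).elim
    | exact (hds A B (by omega)).elim
    | exact (hds B A (by omega)).elim
    | exact (k0 A B (by omega)).elim
    | exact (k0 B A (by omega)).elim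
    | exact (k1 A B (by omega)).elim
    | exact (k1 B A (by omega)).elim
    | exact (k2 A B (by omega)).elim
    | exact (k2 B A (by omega)).elim
    | (cases hdiss A B (by omega); rfl)
    | (cases key A B (by omega); rfl)

/-- The hypotheses of Theorem A follow from the mixed-design property (extracted from
`onePair_mixedClosure_of_isMixedDesign`). -/
theorem onePair_hypotheses_of_isMixedDesign {q : ℕ} (s d : Fin 1 → ℕ) (t : Fin q → ℕ)
    (hD : IsMixedDesign s d t) :
    (∀ A B : Finset (Fin q), subsetSum t A = subsetSum t B → A = B) ∧
    (∀ A B : Finset (Fin q), subsetSum t B ≠ s 0 + subsetSum t A) ∧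
    (∀ A B : Finset (Fin q), subsetSum t B ≠ d 0 + subsetSum t A) ∧
    (∀ A B : Finset (Fin q), s 0 + subsetSum t B ≠ d 0 + subsetSum t A) ∧
    (∀ A₁ A₂ B : Finset (Fin q),
      subsetSum t B = s 0 + d 0 + subsetSum t A₁ → 2 * s 0 + subsetSum t A₁ ≠ d 0 + subsetSum t A₂) := by
  classical
  obtain ⟨_, ys, yd, yt, hy⟩ := hD
  have hy1 : ∀ (a0 b0 : ℤ) (c : Fin q → ℤ), (-1 ≤ a0 ∧ -1 ≤ b0 ∧ a0 + b0 ≤ 1) → (∀ i, -1 ≤ c i ∧ c i ≤ 1) →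
      a0 * (s 0 : ℤ) + b0 * (d 0 : ℤ) + ∑ i, c i * (t i : ℤ) = 0 → (a0 ≠ 0 ∨ b0 ≠ 0 ∨ c ≠ 0) →
      1 ≤ a0 * ys 0 + b0 * yd 0 + ∑ i, c i * yt i := by
    intro a0 b0 c hab hc hv hnz
    have h := hy (fun _ => a0) (fun _ => b0) c ⟨fun _ => hab, hc⟩
      (by simpa [Fin.sum_univ_one] using hv)
      (by
        rcases hnz with h | h | h
        · left; intro hz; exact h (by simpa using congrFun hz 0)
        · right; left; intro hz; exact h (by simpa using congrFun hz 0)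
        · right; right; exact h)
    simpa [Fin.sum_univ_one] using h
  have two : ∀ (a0 b0 : ℤ) (c : Fin q → ℤ), (-1 ≤ a0 ∧ a0 ≤ 1) → (-1 ≤ b0 ∧ b0 ≤ 1) → (-1 ≤ a0 + b0 ∧ a0 + b0 ≤ 1) →
      (∀ i, -1 ≤ c i ∧ c i ≤ 1) → a0 * (s 0 : ℤ) + b0 * (d 0 : ℤ) + ∑ i, c i * (t i : ℤ) = 0 →
      (a0 = 0 ∧ b0 = 0 ∧ c = 0) := by
    intro a0 b0 c ha hb hab hc hv
    by_contra hne
    have hnz : a0 ≠ 0 ∨ b0 ≠ 0 ∨ c ≠ 0 := by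
      by_contra h'
      push Not at h'
      exact hne ⟨h'.1, h'.2.1, h'.2.2⟩
    have i1 := hy1 a0 b0 c ⟨ha.1, hb.1, hab.2⟩ hc hv hnz
    have i2 := hy1 (-a0) (-b0) (fun i => -c i) ⟨by linarith [ha.2], by linarith [hb.2], by linarith [hab.1]⟩
      (fun i => ⟨by linarith [(hc i).2], by linarith [(hc i).1]⟩)
      (by
        have e : (∑ i, (-c i) * (t i : ℤ)) = -∑ i, c i * (t i : ℤ) := by
          rw [← Finset.sum_neg_distrib]; apply Finset.sum_congr rfl; intro i _; ring
        rw [e]; linarith)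
      (by
        rcases hnz with h | h | h
        · left; simpa using h
        · right; left; simpa using h
        · right; right; intro hz; apply h; funext i; have := congrFun hz i; simp at this; simpa using this)
    have e : (∑ i, (-c i) * yt i) = -∑ i, c i * yt i := by
      rw [← Finset.sum_neg_distrib]; apply Finset.sum_congr rfl; intro i _; ring
    rw [e] at i2
    linarith
  have vss : ∀ A B : Finset (Fin q),
      (∑ i, (chiZ A i - chiZ B i) * (t i : ℤ)) = (subsetSum t A : ℤ) - (subsetSum t B : ℤ) := by
    intro A B
    rw [subsetSum_eq_chi, subsetSum_eq_chi, ← Finset.sum_sub_distrib]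
    apply Finset.sum_congr rfl; intro i _; ring
  have hdiss : ∀ A B : Finset (Fin q), subsetSum t A = subsetSum t B → A = B := by
    intro A B h
    have hc := two 0 0 (fun i => chiZ A i - chiZ B i) (by norm_num) (by norm_num) (by norm_num)
      (fun i => chiZ_sub_bound A B i) (by rw [vss]; push_cast [h]; ring)
    exact eq_of_chiZ_sub_eq_zero A B hc.2.2
  have hs : ∀ A B : Finset (Fin q), subsetSum t B ≠ s 0 + subsetSum t A := by
    intro A B h
    have hc := two 1 0 (fun i => chiZ A i - chiZ B i) (by norm_num) (by norm_num) (by norm_num)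
      (fun i => chiZ_sub_bound A B i)
      (by rw [vss]; have : ((subsetSum t B : ℕ) : ℤ) = (s 0 : ℤ) + (subsetSum t A : ℤ) := by exact_mod_cast h
          linarith)
    exact absurd hc.1 one_ne_zero
  have hd : ∀ A B : Finset (Fin q), subsetSum t B ≠ d 0 + subsetSum t A := by
    intro A B h
    have hc := two 0 1 (fun i => chiZ A i - chiZ B i) (by norm_num) (by norm_num) (by norm_num)
      (fun i => chiZ_sub_bound A B i)
      (by rw [vss]; have : ((subsetSum t B : ℕ) : ℤ) = (d 0 : ℤ) + (subsetSum t A : ℤ) := by exact_mod_cast h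
          linarith)
    exact absurd hc.2.1 one_ne_zero
  have hds : ∀ A B : Finset (Fin q), s 0 + subsetSum t B ≠ d 0 + subsetSum t A := by
    intro A B h
    have hc := two 1 (-1) (fun i => chiZ B i - chiZ A i) (by norm_num) (by norm_num) (by norm_num)
      (fun i => chiZ_sub_bound B A i)
      (by rw [vss]; have : (s 0 : ℤ) + (subsetSum t B : ℤ) = (d 0 : ℤ) + (subsetSum t A : ℤ) := by exact_mod_cast h
          linarith)
    exact absurd hc.1 one_ne_zero
  have hconst : ∀ A₁ A₂ B : Finset (Fin q),
      subsetSum t B = s 0 + d 0 + subsetSum t A₁ → 2 * s 0 + subsetSum t A₁ ≠ d 0 + subsetSum t A₂ := by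
    intro A₁ A₂ B h1 h2
    have h1' : ((subsetSum t B : ℕ) : ℤ) = (s 0 : ℤ) + (d 0 : ℤ) + (subsetSum t A₁ : ℤ) := by exact_mod_cast h1
    have h2' : 2 * (s 0 : ℤ) + (subsetSum t A₁ : ℤ) = (d 0 : ℤ) + (subsetSum t A₂ : ℤ) := by exact_mod_cast h2
    let c1 : Fin q → ℤ := fun i => chiZ B i - chiZ A₁ i
    let c2 : Fin q → ℤ := fun i => chiZ A₁ i - chiZ A₂ i
    let c3 : Fin q → ℤ := fun i => chiZ A₂ i - chiZ B i
    have i1 := hy1 (-1) (-1) c1 (by norm_num) (fun i => chiZ_sub_bound B A₁ i)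
      (by simp only [c1]; rw [vss]; linarith) (by left; norm_num)
    have i2 := hy1 2 (-1) c2 (by norm_num) (fun i => chiZ_sub_bound A₁ A₂ i)
      (by simp only [c2]; rw [vss]; linarith) (by left; norm_num)
    have i3 := hy1 (-1) 2 c3 (by norm_num) (fun i => chiZ_sub_bound A₂ B i)
      (by simp only [c3]; rw [vss]; linarith) (by left; norm_num)
    have hsum : (∑ i, c1 i * yt i) + (∑ i, c2 i * yt i) + (∑ i, c3 i * yt i) = 0 := by
      rw [← Finset.sum_add_distrib, ← Finset.sum_add_distrib]
      apply Finset.sum_eq_zero; intro i _; simp only [c1, c2, c3]; ring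
    linarith
  exact ⟨hdiss, hs, hd, hds, hconst⟩

open Classical in
/-- The T-oriented choice of representatives realising `Ψ`: trade `s + d ↦ 2s` exactly when `s + d + ∑A` is a
subset sum. -/
noncomputable def psiChoice {q : ℕ} (s d : Fin 1 → ℕ) (t : Fin q → ℕ) (m : HWord 1 q) : Fin 1 → Fin 3 :=
  fun _ => if ∃ B : Finset (Fin q), subsetSum t B = s 0 + d 0 + subsetSum t m.2 then 0 else 1

/-- The representative chosen by `psiChoice` has the value `Ψ`. -/
theorem candVal_psiChoice {q : ℕ} (s d : Fin 1 → ℕ) (t : Fin q → ℕ) (m : HWord 1 q) :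
    candVal s d t m (psiChoice s d t m) = psi t (s 0) (d 0) (m.1 0, m.2) := by
  classical
  obtain ⟨L, A⟩ := m
  have hss : ∑ i ∈ A, t i = subsetSum t A := rfl
  unfold candVal psi
  simp only [Fin.sum_univ_one, hss]
  generalize hℓ : L 0 = ℓ
  fin_cases ℓ
  · simp
  · simp
  · simp
  · simp only [Fin.reduceFinMk, ↓reduceIte, psiChoice, pairValue]
    simp only [Fin.isValue, Matrix.cons_val]
    split_ifs <;> simp

/-- **Oriented Theorem A.**  For every one-pair mixed design the orientation `T` (all trades towards `2s`) works. -/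
theorem onePair_orientedHallSix_T {q : ℕ} (s d : Fin 1 → ℕ) (t : Fin q → ℕ) (hD : IsMixedDesign s d t) :
    OrientedHallSix s d t (fun _ => false) := by
  classical
  have hsd : s 0 < d 0 := hD.1 0
  obtain ⟨hdiss, hs, hd, hds, hconst⟩ := onePair_hypotheses_of_isMixedDesign s d t hD
  have hinj := psi_injective t (s 0) (d 0) hdiss hs hd hds hconst
  refine ⟨psiChoice s d t, fun m k => ?_, fun m => ?_, fun m₁ m₂ hm => ?_⟩
  · by_cases h : ∃ B : Finset (Fin q), subsetSum t B = s 0 + d 0 + subsetSum t m.2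
    · right; simp [psiChoice, h]
    · left; simp [psiChoice, h]
  · rw [candVal_psiChoice]
    have := psi_le t (s 0) (d 0) hsd (m.1 0, m.2)
    simpa [mixedSigma, Fin.sum_univ_one, Nat.add_assoc] using this
  · have h' : psi t (s 0) (d 0) (m₁.1 0, m₁.2) = psi t (s 0) (d 0) (m₂.1 0, m₂.2) := by
      have := hm
      simp only [candVal_psiChoice] at this
      exact this
    have hpair := hinj h'
    simp only [Prod.mk.injEq] at hpair
    refine Prod.ext (funext fun k => ?_) hpair.2
    rw [Fin.eq_zero k]  -- k = 0
    exact hpair.1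

/-- Hence every one-pair mixed design has at least one working orientation (and HALL-6). -/
theorem onePair_workingOrientations_pos {q : ℕ} (s d : Fin 1 → ℕ) (t : Fin q → ℕ) (hD : IsMixedDesign s d t) :
    1 ≤ workingOrientations s d t := by
  classical
  unfold workingOrientations
  exact Finset.card_pos.2 ⟨_, Finset.mem_filter.2 ⟨Finset.mem_univ _, onePair_orientedHallSix_T s d t hD⟩⟩

end Summit.MatrixMultiplication.MatrixMultiplication.Theorems
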